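import Summits.CriticalPhenomena.PercolationContinuityZ3.Theorems.PercLowPointHalfSpaceQuantitativeBGNWallTwoGhostMoment
import HarnessLib

/-!
# `QuantitativeBGN` (stmt-CriticalPhenomena-0913), line `longrange-wall-ghost-bootstrap` — K1, removing the truncation

Part of the stub `stub_wallTwoGhost` (K1, basic two-ghost inequality on the wall; template
`Literature/Probability/Percolation/TwoGhostInequalityProofs.lean`, Step 5). The second-moment bound of
`…WallTwoGhostMoment.lean` is stated for the truncated configurations `ω_L = ω ∩ E(trG L)`; here the
truncation is removed by Fatou's lemma over `L → ∞` (namespace `…Theorems.WallTwoGhost`):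

* `Z^c` depends only on `C_H(0)` and on the states of the bonds `{u, u+x}` (`u ∈ ∂H`, `x ∈ s`), so
  `Z^c(ω_L) = Z^c(ω)` once the truncated `H`-cluster of `0` is the full one and `L` covers the types;
* almost surely a finite `C_H(0)` is reached by the truncations (`…WallTwoGhostGraph.lean`), so the
  truncated integrands are eventually the untruncated one, and
  **`E[(Z^c)² ; C_H(0) finite, F ≤ N] ≤ 4 N V_c`** (`lintegral_Zc_sq_le`, registered as
  `wallTwoGhost_second_moment`).
-/

noncomputable section

namespace Summit.CriticalPhenomena.PercolationContinuityZ3.Theorems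

open MeasureTheory Filter Literature.Probability.Percolation Literature.Probability.LatticeModels
open Summit.CriticalPhenomena.PercolationContinuityZ3.Theorems.WallGhost
open scoped ENNReal

namespace WallTwoGhost
/-! ### Removing the truncation: Fatou over `L → ∞` -/

section Fatou

variable (p : unitInterval) (lam α : ℝ) (c : Site 3 → ℝ) (s : Finset (Site 3))

/-- `Z^c` only depends on the `H`-cluster of `0` and on the states of the bonds `{u, u + x}` (`u ∈ ∂H`,
`x ∈ s`): two configurations agreeing on these have the same `Z^c`. [folklore] -/
theorem Zc_congr {ω ω' : BondConfig (Site 3)} (hC : clusterH ω' 0 = clusterH ω 0)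
    (hω : ∀ x ∈ s, ∀ u : Site 3, u 0 = 0 → (s(u, u + x) ∈ ω' ↔ s(u, u + x) ∈ ω)) :
    Zc p lam α c s ω' = Zc p lam α c s ω := by
  unfold Zc
  refine Finset.sum_congr rfl fun x hx => ?_
  have hlab : labTouch ω' x = labTouch ω x := by
    ext u; rw [mem_labTouch, mem_labTouch, hC]
  have h1 : nAll ω' x = nAll ω x := by rw [nAll, nAll, hlab]
  have h2 : nSt true ω' x = nSt true ω x := by
    rw [nSt, nSt, hlab]
    congr 1
    ext u
    simp only [Set.mem_setOf_eq, iff_true]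
    exact and_congr_right fun hu => hω x hx u hu.1
  rw [h1, h2]

/-- The truncated statistic coincides with `Z^c` once the truncated cluster is the full one and the
range `L` covers the types. [folklore] -/
theorem Zc_trunc_eq {ω : BondConfig (Site 3)} {L : ℕ} (hs : ∀ x ∈ s, x 0 = 0 ∧ x ≠ 0 ∧ ‖x‖ ≤ L)
    (hC : clusterH (ω ∩ (trG L).edgeSet) 0 = clusterH ω 0) :
    Zc p lam α c s (ω ∩ (trG L).edgeSet) = Zc p lam α c s ω :=
  Zc_congr p lam α c s hC fun x hx _ hu =>
    ⟨fun h => h.1, fun h => ⟨h, mk_add_mem_edgeSet_trG hu (hs x hx).1 (hs x hx).2.1 (hs x hx).2.2⟩⟩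

/-- The truncated integrand of the second-moment bound is measurable. [folklore] -/
theorem measurable_trunc_integrand (L T N : ℕ) :
    Measurable fun ω : BondConfig (Site 3) =>
      {ω : BondConfig (Site 3) | (clusterH (ω ∩ (trG L).edgeSet) 0).Finite ∧
        (clusterH (ω ∩ (trG L).edgeSet) 0).ncard * (6 + (2 * L + 1) ^ 3) ≤ T ∧ footN (ω ∩ (trG L).edgeSet) 0 ≤ N}.indicator
        (fun ω => ENNReal.ofReal (Zc p lam α c s (ω ∩ (trG L).edgeSet) ^ 2)) ω := by
  have hr : Measurable fun ω : BondConfig (Site 3) => ω ∩ (trG L).edgeSet :=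
    measurable_set_iff.2 fun e => (measurable_set_mem e).and measurable_const
  have hA : MeasurableSet {ω' : BondConfig (Site 3) | (clusterH ω' 0).Finite ∧
      (clusterH ω' 0).ncard * (6 + (2 * L + 1) ^ 3) ≤ T ∧ footN ω' 0 ≤ N} := by
    refine (measurableSet_finite_clusterH 0).inter (MeasurableSet.inter ?_ ?_)
    · exact (measurable_ncard.comp (WallBootstrap.measurable_clusterH 0))
        (MeasurableSet.of_discrete (s := {m : ℕ | m * (6 + (2 * L + 1) ^ 3) ≤ T}))
    · exact (measurable_footN 0) (MeasurableSet.of_discrete (s := {m : ℕ | m ≤ N}))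
  have hg : Measurable fun ω' : BondConfig (Site 3) => ENNReal.ofReal (Zc p lam α c s ω' ^ 2) :=
    ENNReal.measurable_ofReal.comp ((measurable_Zc p lam α c s).pow_const 2)
  exact (hg.indicator hA).comp hr

/-- **The untruncated second-moment bound** (Fatou over the truncations): for nonnegative weights on
finitely many long wall-bond types, `E[(Z^c)² ; C_H(0) finite, F ≤ N] ≤ 4 N V_c`.
[cite: Hutchcroft2020Locality, §3, proof of Thm. 1.6] -/
theorem lintegral_Zc_sq_le (hs : ∀ x ∈ s, x 0 = 0 ∧ x ≠ 0) (hc : ∀ x ∈ s, 0 ≤ c x) (N : ℕ) :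
    ∫⁻ ω, {ω : BondConfig (Site 3) | (clusterH ω 0).Finite ∧ footN ω 0 ≤ N}.indicator
        (fun ω => ENNReal.ofReal (Zc p lam α c s ω ^ 2)) ω ∂(augWall p lam α) ≤
      ENNReal.ofReal (N * (4 * Vc p lam α c s)) := by
  classical
  set μ := augWall p lam α with hμ
  -- a common range for the types
  obtain ⟨L₀, hL₀⟩ : ∃ L₀ : ℕ, ∀ x ∈ s, ‖x‖ ≤ L₀ := by
    obtain ⟨M, hM⟩ := Finset.exists_le (s.image fun x => ⌈‖x‖⌉₊)
    exact ⟨M, fun x hx => (Nat.le_ceil _).trans (by exact_mod_cast hM _ (Finset.mem_image_of_mem _ hx))⟩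
  have hs' : ∀ L, ∀ x ∈ s, x 0 = 0 ∧ x ≠ 0 ∧ ‖x‖ ≤ ((L + L₀ : ℕ) : ℝ) := fun L x hx =>
    ⟨(hs x hx).1, (hs x hx).2, (hL₀ x hx).trans (by exact_mod_cast Nat.le_add_left L₀ L)⟩
  -- the truncated integrands
  set D : ℕ → ℕ := fun L => 6 + (2 * (L + L₀) + 1) ^ 3 with hD
  set f : ℕ → BondConfig (Site 3) → ℝ≥0∞ := fun L ω =>
    {ω : BondConfig (Site 3) | (clusterH (ω ∩ (trG (L + L₀)).edgeSet) 0).Finite ∧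
      (clusterH (ω ∩ (trG (L + L₀)).edgeSet) 0).ncard * (6 + (2 * (L + L₀) + 1) ^ 3) ≤ L * D L ∧
      footN (ω ∩ (trG (L + L₀)).edgeSet) 0 ≤ N}.indicator
      (fun ω => ENNReal.ofReal (Zc p lam α c s (ω ∩ (trG (L + L₀)).edgeSet) ^ 2)) ω with hf
  have hfm : ∀ L, Measurable (f L) := fun L => measurable_trunc_integrand p lam α c s (L + L₀) (L * D L) N
  have hfle : ∀ L, ∫⁻ ω, f L ω ∂μ ≤ ENNReal.ofReal (N * (4 * Vc p lam α c s)) := fun L =>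
    lintegral_trunc_Zc_sq_le p lam α c (L * D L) N (hs' L) hc
  -- pointwise, the truncated integrands are eventually the untruncated one
  have hpt : ∀ᵐ ω ∂μ, {ω : BondConfig (Site 3) | (clusterH ω 0).Finite ∧ footN ω 0 ≤ N}.indicator
      (fun ω => ENNReal.ofReal (Zc p lam α c s ω ^ 2)) ω ≤ liminf (fun L => f L ω) atTop := by
    filter_upwards [ae_res_subset p lam α] with ω hω
    by_cases hmem : ω ∈ {ω : BondConfig (Site 3) | (clusterH ω 0).Finite ∧ footN ω 0 ≤ N}
    · obtain ⟨hfin, hN⟩ := hmem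
      have hev : ∀ᶠ L in atTop, f L ω = ENNReal.ofReal (Zc p lam α c s ω ^ 2) := by
        have h1 : ∀ᶠ L : ℕ in atTop, clusterH (ω ∩ (trG (L + L₀)).edgeSet) 0 = clusterH ω 0 :=
          (tendsto_add_atTop_nat L₀).eventually (eventually_clusterH_trunc_eq hω hfin)
        have h2 : ∀ᶠ L : ℕ in atTop, (clusterH ω 0).ncard ≤ L := eventually_ge_atTop _
        filter_upwards [h1, h2] with L hL1 hL2
        have hmemL : ω ∈ {ω : BondConfig (Site 3) | (clusterH (ω ∩ (trG (L + L₀)).edgeSet) 0).Finite ∧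
            (clusterH (ω ∩ (trG (L + L₀)).edgeSet) 0).ncard * (6 + (2 * (L + L₀) + 1) ^ 3) ≤ L * D L ∧
            footN (ω ∩ (trG (L + L₀)).edgeSet) 0 ≤ N} := by
          refine ⟨by rw [hL1]; exact hfin, ?_, ?_⟩
          · rw [hL1]; exact Nat.mul_le_mul_right _ hL2
          · rw [footN, hL1]; exact hN
        simp only [hf, Set.indicator_of_mem hmemL]
        rw [Zc_trunc_eq p lam α c s (hs' L) hL1]
      rw [Set.indicator_of_mem (show ω ∈ {ω : BondConfig (Site 3) | (clusterH ω 0).Finite ∧ footN ω 0 ≤ N} from ⟨hfin, hN⟩),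
        Filter.liminf_congr hev, Filter.liminf_const]
    · rw [Set.indicator_of_notMem hmem]; exact bot_le
  calc ∫⁻ ω, {ω : BondConfig (Site 3) | (clusterH ω 0).Finite ∧ footN ω 0 ≤ N}.indicator
          (fun ω => ENNReal.ofReal (Zc p lam α c s ω ^ 2)) ω ∂μ
      ≤ ∫⁻ ω, liminf (fun L => f L ω) atTop ∂μ := lintegral_mono_ae hpt
    _ ≤ liminf (fun L => ∫⁻ ω, f L ω ∂μ) atTop := lintegral_liminf_le hfm
    _ ≤ ENNReal.ofReal (N * (4 * Vc p lam α c s)) := liminf_le_of_frequently_le (Frequently.of_forall hfle)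

end Fatou


end WallTwoGhost

open WallTwoGhost in
/-- **K1, part 6 (untruncated second moment).** For nonnegative weights on finitely many long
wall-bond types, `E[(Z^c)² ; C_H(0) finite, F ≤ N] ≤ 4 N V_c` under the augmented model (truncated
exploration martingale and Fatou over the truncations). [cite: Hutchcroft2020Locality, §3, proof of Thm. 1.6] -/
theorem wallTwoGhost_second_moment : ∀ (p : unitInterval) (lam α : ℝ) (c : Site 3 → ℝ) (s : Finset (Site 3)), (∀ x ∈ s, x 0 = 0 ∧ x ≠ 0) → (∀ x ∈ s, 0 ≤ c x) → ∀ N : ℕ, ∫⁻ ω, {ω : BondConfig (Site 3) | (clusterH ω 0).Finite ∧ footN ω 0 ≤ N}.indicator (fun ω => ENNReal.ofReal (Zc p lam α c s ω ^ 2)) ω ∂(augWall p lam α) ≤ ENNReal.ofReal (N * (4 * Vc p lam α c s)) :=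
  fun p lam α c s hs hc N => lintegral_Zc_sq_le p lam α c s hs hc N

end Summit.CriticalPhenomena.PercolationContinuityZ3.Theorems
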